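import Mathlib.GroupTheory.OrderOfElement
import Summits.QuantumAdvantage.QuantumAdvantage.Theorems.WhiteBoxWalkWbwVerifiableLineNoSpeedupCycleSurgeryAnatomy

/-!
# Crux `WhiteBoxWalk.WbwVerifiableLineNoSpeedup` (stmt-QuantumAdvantage-2239), line
`cycle-surgery-adversary` — registered stub `stub_partnerFamily` (lead prover)

The partners used by the min-degree bound stay in the prefix-pinned long-cycle family: for `S` in the
family and a cut `pre ≤ k < T`, (merge) `S * swap(x_k, v)` for `v` off the source cycle is in the
family with sink `S^(T-k) v`; (far split) `S * swap(x_k, x_q)` for a cycle position `q` with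
`k + hid < q`, `q + (T - k) < srcPeriod S` is in the family with sink `x_{q+T-k}`. The orbits of the
two modified rows under the new permutation are followed explicitly (`pow_surgery_apply`), which gives
the new line ((F2) and the sink); (F3) transfers by `surgery_periodFree`; (F1) because neither modified
row is a prefix row. Sorry-free. -/

noncomputable section

set_option linter.dupNamespace false

namespace Summit.QuantumAdvantage.QuantumAdvantage.Theorems.WbwVerifiableLineNoSpeedup.CycleSurgery

open Literature.Computability.Cryptography Literature.Computability.QuantumComplexity

/-! ## §5 Partners stay in the family (lead prover; registered stub `stub_partnerFamily`) -/

section Partner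

variable {m T : ℕ}

/-- Following an orbit of `S * swap(a, v)` from `x` while it avoids the two modified rows. -/
theorem pow_surgery_apply {S : Equiv.Perm (Fin (2 ^ m))} {a v x y : Fin (2 ^ m)}
    (h1 : (S * Equiv.swap a v) x = y) {n : ℕ}
    (hfree : ∀ i : ℕ, i < n → (S ^ i) y ≠ a ∧ (S ^ i) y ≠ v) :
    ∀ i : ℕ, i ≤ n → ((S * Equiv.swap a v) ^ (i + 1)) x = (S ^ i) y := by
  intro i
  induction i with
  | zero => intro _; simpa using h1
  | succ i ih =>
    intro hi
    have h := ih (Nat.le_of_succ_le hi)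
    obtain ⟨ha, hv⟩ := hfree i hi
    rw [pow_succ', Equiv.Perm.mul_apply, h, surgery_apply_of_ne S ha hv, ← Equiv.Perm.mul_apply,
      ← pow_succ']

/-- **Transfer of (F3).** If every point has `S`-period `> h` and the two modified rows `a`, `v` have
`S * swap(a, v)`-period `> h`, then every point has `S * swap(a, v)`-period `> h` (an orbit that
avoids `a`, `v` for `h` steps is an `S`-orbit; one that hits `a` or `v` shares its period). -/
theorem surgery_periodFree {S : Equiv.Perm (Fin (2 ^ m))} {a v : Fin (2 ^ m)} {h : ℕ}
    (hF3 : ∀ x : Fin (2 ^ m), ∀ j : ℕ, 0 < j → j ≤ h → (S ^ j) x ≠ x)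
    (ha : ∀ j : ℕ, 0 < j → j ≤ h → ((S * Equiv.swap a v) ^ j) a ≠ a)
    (hv : ∀ j : ℕ, 0 < j → j ≤ h → ((S * Equiv.swap a v) ^ j) v ≠ v) :
    ∀ x : Fin (2 ^ m), ∀ j : ℕ, 0 < j → j ≤ h → ((S * Equiv.swap a v) ^ j) x ≠ x := by
  set S' := S * Equiv.swap a v with hS'
  intro x j hj hjh heq
  by_cases hhit : ∃ i : ℕ, i < j ∧ ((S' ^ i) x = a ∨ (S' ^ i) x = v)
  · obtain ⟨i, -, hy⟩ := hhit
    have hyfix : (S' ^ j) ((S' ^ i) x) = (S' ^ i) x := by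
      rw [← Equiv.Perm.mul_apply, ← pow_add, add_comm, pow_add, Equiv.Perm.mul_apply, heq]
    rcases hy with hy | hy
    · rw [hy] at hyfix
      exact ha j hj hjh hyfix
    · rw [hy] at hyfix
      exact hv j hj hjh hyfix
  · push Not at hhit
    have hfollow : ∀ i : ℕ, i ≤ j → (S' ^ i) x = (S ^ i) x := by
      intro i
      induction i with
      | zero => intro _; simp
      | succ i ih =>
        intro hi
        have hi' : i < j := hi
        obtain ⟨hxa, hxv⟩ := hhit i hi'
        rw [ih hi'.le] at hxa hxv
        rw [pow_succ', Equiv.Perm.mul_apply, ih hi'.le, hS', surgery_apply_of_ne S hxa hxv,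
          ← Equiv.Perm.mul_apply, ← pow_succ']
    exact hF3 x j hj hjh (by rw [← hfollow j le_rfl]; exact heq)

/-- Two orbit points at index distance `d`, `0 < d < srcPeriod`, differ. -/
theorem pt_add_ne_pt {S : Equiv.Perm (Fin (2 ^ m))} (i : ℕ) {d : ℕ} (hd : 0 < d)
    (hdL : d < srcPeriod S) : pt S (i + d) ≠ pt S i := by
  intro h
  have h' : (S ^ i) (pt S d) = (S ^ i) (pt S 0) := by
    rw [← pt_add, ← pt_add, zero_add, add_comm]
    exact h
  have := pt_injOn_lt_srcPeriod S hdL (srcPeriod_pos S) ((S ^ i).injective h')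
  omega

/-- Index form: `pt S j ≠ pt S i` for `i < j < i + srcPeriod S`. -/
theorem pt_ne_pt_of_lt_of_lt {S : Equiv.Perm (Fin (2 ^ m))} {i j : ℕ} (h1 : i < j)
    (h2 : j < i + srcPeriod S) : pt S j ≠ pt S i := by
  obtain ⟨d, rfl⟩ := Nat.exists_eq_add_of_lt h1
  rw [show i + d + 1 = i + (d + 1) by omega]
  exact pt_add_ne_pt i (Nat.succ_pos d) (by omega)

/-- An off-cycle vertex stays off the source cycle under `S`-powers. -/
theorem OffCycle.pow_ne_pt {S : Equiv.Perm (Fin (2 ^ m))} {v : Fin (2 ^ m)} (hv : OffCycle S v)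
    (n j : ℕ) : (S ^ n) v ≠ pt S j := by
  intro h
  have ho : 0 < orderOf S := orderOf_pos S
  apply hv (j + (orderOf S - 1) * n)
  have hn : (orderOf S - 1) * n + n = orderOf S * n := by
    conv_rhs => rw [← Nat.sub_add_cancel ho]
    ring
  rw [pt_add, ← h, ← Equiv.Perm.mul_apply, ← pow_add, hn, pow_mul, pow_orderOf_eq_one, one_pow,
    Equiv.Perm.one_apply]

/-- Cancelling a common `S`-power: `S^a v = S^(a+d) v` forces `S^d v = v`. -/
theorem pow_apply_eq_self_of_pow_apply_eq {S : Equiv.Perm (Fin (2 ^ m))} {v : Fin (2 ^ m)}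
    {a d : ℕ} (h : (S ^ a) v = (S ^ (a + d)) v) : (S ^ d) v = v :=
  (S ^ a).injective (by rw [← Equiv.Perm.mul_apply, ← pow_add]; exact h.symm)

/-- **Registered stub `stub_partnerFamily` (lead).** For `S` in the family and a cut `pre ≤ k < T`:
(merge) for every `v` off the source cycle, `S * swap(x_k, v)` is in the family with sink
`S^(T-k) v`; (far split) for every cycle position `q` with `k + hid < q`, `q + (T - k) < srcPeriod S`,
`S * swap(x_k, x_q)` is in the family with sink `x_{q + T - k}`. Proof: the orbits of the two
modified rows under the new permutation are followed explicitly (`pow_surgery_apply`): from `x_k`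
one runs through `S v, S² v, …` (merge) or `x_{q+1}, x_{q+2}, …` (split), from `v` through
`x_{k+1}, x_{k+2}, …`; this gives the new line (hence (F2) and the sink), and (F3) transfers by
`surgery_periodFree`; (F1) holds because neither modified row is a prefix row. -/
theorem stub_partnerFamily :
    ∀ (m T : ℕ) (S : Equiv.Perm (Fin (2 ^ m))) (k : ℕ), InFamily m T S → pre m T ≤ k → k < T →
      (∀ v : Fin (2 ^ m), OffCycle S v →
          InFamily m T (S * Equiv.swap (pt S k) v) ∧
            pt (S * Equiv.swap (pt S k) v) T = (S ^ (T - k)) v) ∧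
      ∀ q : ℕ, k + hid m T < q → q + (T - k) < srcPeriod S →
          InFamily m T (S * Equiv.swap (pt S k) (pt S q)) ∧
            pt (S * Equiv.swap (pt S k) (pt S q)) T = pt S (q + (T - k)) := by
  intro m T S k hS hk hkT
  have hF1 := hS.1
  have hinj := hS.2.1
  have hF3 := hS.2.2
  have hL : T < srcPeriod S := lt_srcPeriod_of_injective hinj
  have hTk : T - k ≤ hid m T := sub_le_hid_of_pre_le hk
  have hhidT : hid m T ≤ T := hid_le m T
  have hph : pre m T + hid m T = T := pre_add_hid m T
  have hhid1 : 1 ≤ hid m T := by omega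
  -- the cut row is not a prefix row
  have ha_pre : ¬ (pt S k).val < pre m T := by
    intro hlt
    have h1 : pt S (pt S k).val = pt S k := Fin.ext (val_pt_of_le_pre hS _ hlt.le)
    have := pt_injOn_of_injective hinj (by omega) hkT.le h1
    omega
  -- a prefix name is the prefix point with that index
  have hprefix : ∀ x : Fin (2 ^ m), x.val < pre m T → pt S x.val = x := fun x hx =>
    Fin.ext (val_pt_of_le_pre hS _ hx.le)
  constructor
  · ------------------------------------------------------------------ MERGE
    intro v hv
    set a := pt S k with ha
    set S' := S * Equiv.swap a v with hS'
    -- orbit of `a` under `S'`: `S v, S² v, …`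
    have horbA : ∀ i : ℕ, i ≤ hid m T - 1 → (S' ^ (i + 1)) a = (S ^ i) (S v) := by
      refine pow_surgery_apply (surgery_apply_cut S a v) fun i hi => ⟨?_, ?_⟩
      · rw [← Equiv.Perm.mul_apply, ← pow_succ, ha]
        exact hv.pow_ne_pt (i + 1) k
      · rw [← Equiv.Perm.mul_apply, ← pow_succ]
        exact hF3 v (i + 1) (Nat.succ_pos i) (by omega)
    -- orbit of `v` under `S'`: `x_{k+1}, x_{k+2}, …`
    have horbV : ∀ i : ℕ, i ≤ hid m T - 1 → (S' ^ (i + 1)) v = (S ^ i) (S a) := by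
      refine pow_surgery_apply (surgery_apply_v S a v) fun i hi => ⟨?_, ?_⟩
      · rw [← Equiv.Perm.mul_apply, ← pow_succ, ha, ← pt_add]
        exact pt_ne_pt_of_lt_of_lt (by omega) (by omega)
      · rw [← Equiv.Perm.mul_apply, ← pow_succ, ha, ← pt_add]
        exact hv _
    -- the new line: agrees up to `k`, then `S v, S² v, …`
    have hcut : ∀ i : ℕ, i ≤ k → pt S' i = pt S i :=
      pt_surgery_of_le hinj hkT.le fun i _ => (hv i).symm
    have htail : ∀ j : ℕ, k + 1 + j ≤ T → pt S' (k + 1 + j) = (S ^ (j + 1)) v := by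
      intro j hj
      rw [show k + 1 + j = k + (j + 1) by omega, pt_add, hcut k le_rfl, ← ha, horbA j (by omega),
        ← Equiv.Perm.mul_apply, ← pow_succ]
    -- (F2')
    have hinj' : Function.Injective (lineOf m T S') := by
      intro i i' h
      change pt S' i.val = pt S' i'.val at h
      apply Fin.ext
      have hi := i.isLt
      have hi' := i'.isLt
      rcases Nat.lt_or_ge k i.val with hki | hik <;> rcases Nat.lt_or_ge k i'.val with hki' | hik'
      · obtain ⟨j, hj⟩ : ∃ j, i.val = k + 1 + j := ⟨i.val - (k + 1), by omega⟩
        obtain ⟨j', hj'⟩ : ∃ j', i'.val = k + 1 + j' := ⟨i'.val - (k + 1), by omega⟩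
        rw [hj, htail j (by omega), hj', htail j' (by omega)] at h
        rcases Nat.lt_trichotomy j j' with hjj | rfl | hjj
        · obtain ⟨d, rfl⟩ := Nat.exists_eq_add_of_lt hjj
          have := pow_apply_eq_self_of_pow_apply_eq
            (show (S ^ (j + 1)) v = (S ^ (j + 1 + (d + 1))) v by
              rw [h, show j + 1 + (d + 1) = j + d + 1 + 1 by omega])
          exact absurd this (hF3 v (d + 1) (Nat.succ_pos d) (by omega))
        · omega
        · obtain ⟨d, rfl⟩ := Nat.exists_eq_add_of_lt hjj
          have := pow_apply_eq_self_of_pow_apply_eq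
            (show (S ^ (j' + 1)) v = (S ^ (j' + 1 + (d + 1))) v by
              rw [← h, show j' + 1 + (d + 1) = j' + d + 1 + 1 by omega])
          exact absurd this (hF3 v (d + 1) (Nat.succ_pos d) (by omega))
      · exfalso
        obtain ⟨j, hj⟩ : ∃ j, i.val = k + 1 + j := ⟨i.val - (k + 1), by omega⟩
        rw [hj, htail j (by omega), hcut _ hik'] at h
        exact hv.pow_ne_pt _ _ h
      · exfalso
        obtain ⟨j', hj'⟩ : ∃ j', i'.val = k + 1 + j' := ⟨i'.val - (k + 1), by omega⟩
        rw [hj', htail j' (by omega), hcut _ hik] at h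
        exact hv.pow_ne_pt _ _ h.symm
      · rw [hcut _ hik, hcut _ hik'] at h
        exact pt_injOn_of_injective hinj (by omega) (by omega) h
    -- (F1')
    have hF1' : ∀ x : Fin (2 ^ m), x.val < pre m T → (S' x).val = x.val + 1 := by
      intro x hx
      have hxa : x ≠ a := fun h => ha_pre (by rw [← h]; exact hx)
      have hxv : x ≠ v := fun h => hv x.val (by rw [hprefix x hx, h])
      rw [hS', surgery_apply_of_ne S hxa hxv]
      exact hF1 x hx
    -- (F3')
    have hF3' : ∀ x : Fin (2 ^ m), ∀ j : ℕ, 0 < j → j ≤ hid m T → (S' ^ j) x ≠ x := by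
      refine surgery_periodFree hF3 (fun j hj hjh => ?_) (fun j hj hjh => ?_)
      · obtain ⟨i, rfl⟩ : ∃ i, j = i + 1 := ⟨j - 1, by omega⟩
        rw [horbA i (by omega), ← Equiv.Perm.mul_apply, ← pow_succ, ha]
        exact hv.pow_ne_pt (i + 1) k
      · obtain ⟨i, rfl⟩ : ∃ i, j = i + 1 := ⟨j - 1, by omega⟩
        rw [horbV i (by omega), ← Equiv.Perm.mul_apply, ← pow_succ, ha, ← pt_add]
        exact hv _
    refine ⟨⟨hF1', hinj', hF3'⟩, ?_⟩
    -- the sink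
    obtain ⟨j, hj⟩ : ∃ j, T = k + 1 + j := ⟨T - (k + 1), by omega⟩
    have hTk' : T - k = j + 1 := by omega
    rw [hTk', hj, htail j (by omega)]
  · ------------------------------------------------------------------ FAR SPLIT
    intro q hq hqL
    set a := pt S k with ha
    set v := pt S q with hvq
    set S' := S * Equiv.swap a v with hS'
    have hTq : T < q := by omega
    have hvoff : ∀ i : ℕ, i ≤ T → v ≠ pt S i := fun i hi =>
      by rw [hvq]; exact pt_ne_pt_of_lt_of_lt (by omega) (by omega)
    -- orbit of `a` under `S'`: `x_{q+1}, x_{q+2}, …`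
    have horbA : ∀ i : ℕ, i ≤ hid m T - 1 → (S' ^ (i + 1)) a = (S ^ i) (S v) := by
      refine pow_surgery_apply (surgery_apply_cut S a v) fun i hi => ⟨?_, ?_⟩
      · rw [← Equiv.Perm.mul_apply, ← pow_succ, hvq, ← pt_add, ha]
        exact pt_ne_pt_of_lt_of_lt (by omega) (by omega)
      · rw [← Equiv.Perm.mul_apply, ← pow_succ, hvq, ← pt_add]
        exact pt_ne_pt_of_lt_of_lt (by omega) (by omega)
    -- orbit of `v` under `S'`: `x_{k+1}, x_{k+2}, …`
    have horbV : ∀ i : ℕ, i ≤ hid m T - 1 → (S' ^ (i + 1)) v = (S ^ i) (S a) := by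
      refine pow_surgery_apply (surgery_apply_v S a v) fun i hi => ⟨?_, ?_⟩
      · rw [← Equiv.Perm.mul_apply, ← pow_succ, ha, ← pt_add]
        exact pt_ne_pt_of_lt_of_lt (by omega) (by omega)
      · rw [← Equiv.Perm.mul_apply, ← pow_succ, ha, ← pt_add, hvq]
        exact (pt_ne_pt_of_lt_of_lt (by omega) (by omega)).symm
    have hcut : ∀ i : ℕ, i ≤ k → pt S' i = pt S i := pt_surgery_of_le hinj hkT.le hvoff
    have htail : ∀ j : ℕ, k + 1 + j ≤ T → pt S' (k + 1 + j) = pt S (q + 1 + j) := by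
      intro j hj
      rw [show k + 1 + j = k + (j + 1) by omega, pt_add, hcut k le_rfl, ← ha, horbA j (by omega),
        hvq, ← pt_succ, ← pt_add, show q + 1 + j = q + 1 + j from rfl]
    -- (F2')
    have hinj' : Function.Injective (lineOf m T S') := by
      intro i i' h
      change pt S' i.val = pt S' i'.val at h
      apply Fin.ext
      have hi := i.isLt
      have hi' := i'.isLt
      rcases Nat.lt_or_ge k i.val with hki | hik <;> rcases Nat.lt_or_ge k i'.val with hki' | hik'
      · obtain ⟨j, hj⟩ : ∃ j, i.val = k + 1 + j := ⟨i.val - (k + 1), by omega⟩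
        obtain ⟨j', hj'⟩ : ∃ j', i'.val = k + 1 + j' := ⟨i'.val - (k + 1), by omega⟩
        rw [hj, htail j (by omega), hj', htail j' (by omega)] at h
        have := pt_injOn_lt_srcPeriod S (by omega) (by omega) h
        omega
      · exfalso
        obtain ⟨j, hj⟩ : ∃ j, i.val = k + 1 + j := ⟨i.val - (k + 1), by omega⟩
        rw [hj, htail j (by omega), hcut _ hik'] at h
        exact pt_ne_pt_of_lt_of_lt (by omega) (by omega) h
      · exfalso
        obtain ⟨j', hj'⟩ : ∃ j', i'.val = k + 1 + j' := ⟨i'.val - (k + 1), by omega⟩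
        rw [hj', htail j' (by omega), hcut _ hik] at h
        exact pt_ne_pt_of_lt_of_lt (by omega) (by omega) h.symm
      · rw [hcut _ hik, hcut _ hik'] at h
        exact pt_injOn_of_injective hinj (by omega) (by omega) h
    -- (F1')
    have hF1' : ∀ x : Fin (2 ^ m), x.val < pre m T → (S' x).val = x.val + 1 := by
      intro x hx
      have hxa : x ≠ a := fun h => ha_pre (by rw [← h]; exact hx)
      have hxv : x ≠ v := by
        intro h
        have h1 : pt S x.val = pt S q := by rw [hprefix x hx, h]
        have := pt_injOn_lt_srcPeriod S (by omega) (by omega) h1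
        omega
      rw [hS', surgery_apply_of_ne S hxa hxv]
      exact hF1 x hx
    -- (F3')
    have hF3' : ∀ x : Fin (2 ^ m), ∀ j : ℕ, 0 < j → j ≤ hid m T → (S' ^ j) x ≠ x := by
      refine surgery_periodFree hF3 (fun j hj hjh => ?_) (fun j hj hjh => ?_)
      · obtain ⟨i, rfl⟩ : ∃ i, j = i + 1 := ⟨j - 1, by omega⟩
        rw [horbA i (by omega), ← Equiv.Perm.mul_apply, ← pow_succ, hvq, ← pt_add, ha]
        exact pt_ne_pt_of_lt_of_lt (by omega) (by omega)
      · obtain ⟨i, rfl⟩ : ∃ i, j = i + 1 := ⟨j - 1, by omega⟩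
        rw [horbV i (by omega), ← Equiv.Perm.mul_apply, ← pow_succ, ha, ← pt_add, hvq]
        exact (pt_ne_pt_of_lt_of_lt (by omega) (by omega)).symm
    refine ⟨⟨hF1', hinj', hF3'⟩, ?_⟩
    -- the sink
    obtain ⟨j, hj⟩ : ∃ j, T = k + 1 + j := ⟨T - (k + 1), by omega⟩
    have hq' : q + (T - k) = q + 1 + j := by omega
    rw [hq', hj, htail j (by omega)]

end Partner

end Summit.QuantumAdvantage.QuantumAdvantage.Theorems.WbwVerifiableLineNoSpeedup.CycleSurgery

end
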